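import Literature.MathematicalPhysics.QuantumLattice.FermionBoxProductMarginals
import Literature.MathematicalPhysics.QuantumLattice.LayeredSystemPartitionFunction
import Literature.MathematicalPhysics.QuantumLattice.LiebConcavity
import HarnessLib

/-!
# Entropy of a fermionic product state over boxes: `S(Π_k Γ_{φ_k} σ_k) = Σ_k S(σ_k)`

Topic `Literature/MathematicalPhysics/QuantumLattice` (namespace = path; family `hubbard`, model-free). Sequel of
`FermionBoxProductMarginals.lean` (the box product `boxProd φ hφ σ hσ S = Π_{k∈S} Γ_{φ_k}(σ_k)` of `Θ`-even box
operators along boxes `φ_k : Λ₀ k ↪ Λ` with pairwise disjoint images). For FAITHFUL (positive definite) even box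
density matrices `σ_k` on boxes TILING `Λ` the von Neumann entropy of the product state is additive,

  `S(Π_k Γ_{φ_k} σ_k) = Σ_k S(σ_k)`   (`vonNeumannEntropy_boxProd`),

proved WITHOUT Jordan–Wigner coordinates, through the modular Hamiltonian: `log σ_k` is even (functional calculus
commutes with the parity automorphism), the `Γ_{φ_k}(log σ_k)` commute pairwise, so
`Π_k Γ_{φ_k} σ_k = Π_k Γ_{φ_k} e^{log σ_k} = exp(Σ_k Γ_{φ_k} log σ_k)` (`Matrix.exp_sum_of_commute`, `Γ ∘ exp = exp ∘ Γ`) is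
the Gibbs state at `β = 1` of `H₀ = −Σ_k Γ_{φ_k} log σ_k` with `Z = tr Π_k Γ σ_k = 1`; its entropy is
`log Z + ⟨H₀⟩ = −Σ_k tr(Π Γσ · Γ_{φ_k} log σ_k) = −Σ_k tr(σ_k log σ_k)` by the one-box product formula
(`normTrace_boxProd_mul_fermionEmbed`). The order-interval (Jordan–Wigner) route to the same additivity, for two
factors and for lexicographic stacks of boxes in `ℤ^d` and without faithfulness, is
`FermionProductStateEntropy(Chain).lean`; the present file covers ARBITRARY box families in an arbitrary finite
ordered site set (e.g. the boxes of a torus, which are not order intervals), which is what the seam-dressed cluster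
trial states of the `T > 0` Hubbard certificate C3 need (entropy side of the Gibbs variational principle).

* `parityAut_cfc_of_parityAut_eq` — `Θ(f(X)) = f(X)` for `Θ`-even Hermitian `X` (real functional calculus);
* `exp_cfc_log_of_posDef` — `exp(log Y) = Y` for positive definite `Y` (any index type/universe);
* `gibbsWeight_modular_eq_boxProd`, `trace_boxProd_mul_fermionEmbed` (`tr(Π Γσ · Γ_j b) = tr(σ_j b)` for box
  density matrices tiling `Λ`), `vonNeumannEntropy_boxProd`.

Everything is PROVED; no definition, no named fact. HONEST LIMIT: faithfulness (`PosDef`) of the box states is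
assumed (a singular box state is handled downstream by mixing in `δ·𝟙/dim`).

## Tree / Mathlib search

REUSED: `boxProd`, `normTrace_boxProd_mul_fermionEmbed`, `trace_boxProd_univ_eq_one`, `pairwise_commute_fermionEmbed_box`
(`FermionBoxProductMarginals`); `fermionEmbed_exp` (`LayeredSystemPartitionFunction`); `parityAut_apply`;
`Matrix.IsHermitian.vonNeumannEntropy_gibbsDensity`, `gibbsEntropy_def`, `gibbsState_apply`
(`GibbsVariationalPrinciple`, `GibbsEntropy`, `FinDimSpectrum`); `re_trace_mul_cfc_log`
(`Literature.InformationTheory.Entropy`); Mathlib `Commute.cfc_real`, `CFC.exp_log`, `Matrix.PosDef.isStrictlyPositive`,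
`Matrix.exp_sum_of_commute`. `lean search 'vonNeumannEntropy.*noncommProd|entropy.*product state'`: only the
Jordan–Wigner files above (2026-08-27).

## References

* H. Araki, H. Moriya, Rev. Math. Phys. 15 (2003) 93, §4.3 (product states of even states), §11.1 Thm. 11.2.
  [cite: ArakiMoriya2003, §4.3]
* M. A. Nielsen, I. L. Chuang, *Quantum Computation and Quantum Information* (2010), §11.3.4 eq. (11.58)
  (additivity of the von Neumann entropy on product states). [cite: NielsenChuang2010, §11.3.4 eq. (11.58)]
* D. Petz, *Quantum Information Theory and Quantum Statistics* (2008), §3.7 (Gibbs states `e^{−H}/Z`, entropy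
  `log Z + ⟨H⟩`), §11.6 (functional calculus `exp ∘ log`). [cite: Petz2008, §3.7]
-/

noncomputable section

namespace Literature.MathematicalPhysics.QuantumLattice

open Matrix Finset HubbardWave0
open scoped ComplexOrder BigOperators
open Literature.InformationTheory.Entropy (vonNeumannEntropy re_trace_mul_cfc_log)

/-! ### §1. Even operators: parity commutes with the real functional calculus; `exp ∘ log` -/

section Parity

variable {κ₀ : Type*} [LinearOrder κ₀] [Fintype κ₀]

/-- `P² = 𝟙` for the parity operator `P = (−1)^N` (re-derived locally). [cite: ArakiMoriya2003, §4.1 Def. 4.2] -/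
private theorem parityOp_mul_parityOp_loc : (parityOp : Matrix (Finset κ₀) (Finset κ₀) ℂ) * parityOp = 1 := by
  rw [parityOp, Matrix.diagonal_mul_diagonal, ← Matrix.diagonal_one]
  congr 1
  funext s
  rw [← pow_add, ← two_mul, pow_mul, neg_one_sq, one_pow]

/-- A `Θ`-even operator commutes with the parity operator: `Θ X = X ⇒ P X = X P`.
[cite: ArakiMoriya2003, §4.1 Def. 4.2] -/
theorem commute_parityOp_of_parityAut_eq {X : Matrix (Finset κ₀) (Finset κ₀) ℂ} (hX : parityAut X = X) :
    Commute parityOp X := by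
  have h : parityAut X * parityOp = X * parityOp := by rw [hX]
  rw [parityAut_apply, Matrix.mul_assoc, parityOp_mul_parityOp_loc, Matrix.mul_one] at h
  exact h

/-- Conversely `P X = X P ⇒ Θ X = X`. [cite: ArakiMoriya2003, §4.1 Def. 4.2] -/
theorem parityAut_eq_of_commute_parityOp {X : Matrix (Finset κ₀) (Finset κ₀) ℂ} (h : Commute parityOp X) :
    parityAut X = X := by
  rw [parityAut_apply, h.eq, Matrix.mul_assoc, parityOp_mul_parityOp_loc, Matrix.mul_one]

/-- **The real functional calculus of an even operator is even**: `Θ(f(X)) = f(X)` when `Θ X = X` (e.g. the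
modular Hamiltonian `log σ` of an even density matrix). [cite: ArakiMoriya2003, §4.1 Def. 4.2] -/
theorem parityAut_cfc_of_parityAut_eq {X : Matrix (Finset κ₀) (Finset κ₀) ℂ} (hX : parityAut X = X) (f : ℝ → ℝ) :
    parityAut (cfc f X) = cfc f X :=
  parityAut_eq_of_commute_parityOp ((commute_parityOp_of_parityAut_eq hX).symm.cfc_real f).symm

/-- **`exp(log Y) = Y`** for a positive definite complex matrix (functional calculus; any index type).
[cite: Petz2008, §11.6] -/
theorem exp_cfc_log_of_posDef {n : Type*} [Fintype n] [DecidableEq n] {Y : Matrix n n ℂ} (hY : Y.PosDef) :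
    NormedSpace.exp (cfc Real.log Y) = Y := by
  open scoped Matrix.Norms.L2Operator MatrixOrder in
  exact by
    letI : CStarAlgebra (Matrix n n ℂ) := {}
    have h := CFC.exp_log (A := Matrix n n ℂ) Y hY.isStrictlyPositive
    rwa [CFC.log] at h

end Parity

/-! ### §2. The box product of faithful even density matrices is a Gibbs state; its entropy is additive -/

section Entropy

variable {Λ : Type*} [LinearOrder Λ] [Fintype Λ] {K : Type*} [Fintype K] [DecidableEq K]
  {Λ₀ : K → Type*} [∀ k, LinearOrder (Λ₀ k)] [∀ k, Fintype (Λ₀ k)]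
  {φ : ∀ k, Λ₀ k ↪ Λ}
  (hφ : ∀ k j, k ≠ j → Disjoint ((Finset.univ : Finset (Λ₀ k)).map (φ k)) ((Finset.univ : Finset (Λ₀ j)).map (φ j)))
include hφ

omit hφ in
/-- Orbital count: `|Orb X| = 2 |X|` (two spins per site; re-derived locally). [folklore] -/
private theorem card_orb_eq_two_mul' (X : Type*) [LinearOrder X] [Fintype X] :
    Fintype.card (Orb X) = 2 * Fintype.card X := by
  rw [Fintype.card_congr (show Orb X ≃ X × Fin 2 from (toLex : X × Fin 2 ≃ Orb X).symm), Fintype.card_prod,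
    Fintype.card_fin, mul_comm]

omit [DecidableEq K] hφ in
/-- For boxes TILING `Λ` (`Σ_k |Λ₀ k| = |Λ|`): `2^{|Orb Λ|} = Π_k 2^{|Orb (Λ₀ k)|}`. [folklore] -/
private theorem two_pow_card_orb_eq_prod (hcard : ∑ k, Fintype.card (Λ₀ k) = Fintype.card Λ) :
    (2 : ℂ) ^ Fintype.card (Orb Λ) = ∏ k, (2 : ℂ) ^ Fintype.card (Orb (Λ₀ k)) := by
  rw [Finset.prod_pow_eq_pow_sum, card_orb_eq_two_mul']
  simp_rw [card_orb_eq_two_mul']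
  rw [← Finset.mul_sum, hcard]

/-- **One-box expectations of a product state**: for even box density matrices `σ_k` (`tr σ_k = 1`) on boxes
tiling `Λ` and any observable `b` of box `j`, `tr(Π_k Γ_{φ_k} σ_k · Γ_{φ_j} b) = tr(σ_j b)`.
[cite: ArakiMoriya2003, §11.1 Theorem 11.2 eq. (11.4)] -/
theorem trace_boxProd_mul_fermionEmbed {σ : ∀ k, Matrix (Finset (Orb (Λ₀ k))) (Finset (Orb (Λ₀ k))) ℂ}
    (hσ : ∀ k, parityAut (σ k) = σ k) (htr : ∀ k, (σ k).trace = 1)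
    (hcard : ∑ k, Fintype.card (Λ₀ k) = Fintype.card Λ) (j : K)
    (b : Matrix (Finset (Orb (Λ₀ j))) (Finset (Orb (Λ₀ j))) ℂ) :
    (boxProd hφ σ hσ Finset.univ * fermionEmbed (φ j) b).trace = (σ j * b).trace := by
  have h := normTrace_boxProd_mul_fermionEmbed hφ hσ (Finset.mem_univ j) b
  simp only [normTrace_apply, htr, one_div] at h
  rw [div_eq_iff (pow_ne_zero _ two_ne_zero)] at h
  rw [h, two_pow_card_orb_eq_prod hcard, ← Finset.mul_prod_erase Finset.univ _ (Finset.mem_univ j),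
    Finset.prod_inv_distrib]
  have hne : ∏ k ∈ Finset.univ.erase j, (2 : ℂ) ^ Fintype.card (Orb (Λ₀ k)) ≠ 0 :=
    Finset.prod_ne_zero_iff.2 fun k _ => pow_ne_zero _ two_ne_zero
  field_simp

omit [DecidableEq K] in
/-- **The box product of faithful even density matrices is the `β = 1` Gibbs weight of the modular Hamiltonian**
`H₀ = −Σ_k Γ_{φ_k}(log σ_k)`: `e^{−H₀} = Π_k Γ_{φ_k} σ_k` (the summands are even, hence commute; `Γ ∘ exp = exp ∘ Γ`;
`exp(log σ_k) = σ_k`). [cite: Petz2008, §3.7] [cite: ArakiMoriya2003, §4.3] -/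
theorem gibbsWeight_modular_eq_boxProd {σ : ∀ k, Matrix (Finset (Orb (Λ₀ k))) (Finset (Orb (Λ₀ k))) ℂ}
    (hσ : ∀ k, parityAut (σ k) = σ k) (hpd : ∀ k, (σ k).PosDef) :
    Matrix.gibbsWeight 1 (-∑ k, fermionEmbed (φ k) (cfc Real.log (σ k))) = boxProd hφ σ hσ Finset.univ := by
  have hℓev : ∀ k, parityAut (cfc Real.log (σ k)) = cfc Real.log (σ k) :=
    fun k => parityAut_cfc_of_parityAut_eq (hσ k) Real.log
  have hsmul : -((1 : ℝ) : ℂ) • (-∑ k, fermionEmbed (φ k) (cfc Real.log (σ k))) =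
      ∑ k, fermionEmbed (φ k) (cfc Real.log (σ k)) := by
    rw [Complex.ofReal_one, neg_one_smul, neg_neg]
  rw [Matrix.gibbsWeight, hsmul, Matrix.exp_sum_of_commute Finset.univ (fun k => fermionEmbed (φ k) (cfc Real.log (σ k)))
    (pairwise_commute_fermionEmbed_box hφ hℓev _)]
  unfold boxProd
  refine Finset.noncommProd_congr rfl (fun k _ => ?_) _
  rw [← fermionEmbed_exp, exp_cfc_log_of_posDef (hpd k)]

/-- **Entropy additivity of fermionic product states over boxes**: for FAITHFUL `Θ`-even density matrices
`σ_k` (`σ_k ≻ 0`, `tr σ_k = 1`) on boxes `φ_k : Λ₀ k ↪ Λ` with pairwise disjoint images TILING `Λ`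
(`Σ_k |Λ₀ k| = |Λ|`),  `S(Π_k Γ_{φ_k} σ_k) = Σ_k S(σ_k)`.
[cite: NielsenChuang2010, §11.3.4 eq. (11.58)] [cite: ArakiMoriya2003, §4.3] -/
theorem vonNeumannEntropy_boxProd {σ : ∀ k, Matrix (Finset (Orb (Λ₀ k))) (Finset (Orb (Λ₀ k))) ℂ}
    (hσ : ∀ k, parityAut (σ k) = σ k) (hpd : ∀ k, (σ k).PosDef) (htr : ∀ k, (σ k).trace = 1)
    (hcard : ∑ k, Fintype.card (Λ₀ k) = Fintype.card Λ) :
    vonNeumannEntropy (boxProd hφ σ hσ Finset.univ) = ∑ k, vonNeumannEntropy (σ k) := by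
  -- the modular Hamiltonian `H₀ = −Σ_k Γ_k log σ_k`
  set H₀ : Matrix (Finset (Orb Λ)) (Finset (Orb Λ)) ℂ := -∑ k, fermionEmbed (φ k) (cfc Real.log (σ k)) with hH₀def
  have hℓherm : ∀ k, (cfc Real.log (σ k)).IsHermitian := fun k => (cfc_predicate Real.log (σ k) : IsSelfAdjoint _)
  have hH₀ : H₀.IsHermitian := by
    change (-∑ k, fermionEmbed (φ k) (cfc Real.log (σ k)))ᴴ = -∑ k, fermionEmbed (φ k) (cfc Real.log (σ k))
    rw [Matrix.conjTranspose_neg, Matrix.conjTranspose_sum]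
    congr 1
    refine Finset.sum_congr rfl fun k _ => ?_
    rw [← fermionEmbed_conjTranspose, (hℓherm k).eq]
  have hexp : Matrix.gibbsWeight 1 H₀ = boxProd hφ σ hσ Finset.univ := gibbsWeight_modular_eq_boxProd hφ hσ hpd
  have hZ : Matrix.partitionFn 1 H₀ = 1 := by
    rw [Matrix.partitionFn, hexp, trace_boxProd_univ_eq_one hφ hσ htr hcard]
  -- the entropy of the Gibbs state is `log Z + ⟨H₀⟩`
  haveI : Nonempty (Finset (Orb Λ)) := ⟨∅⟩
  have hS := hH₀.vonNeumannEntropy_gibbsDensity 1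
  rw [hZ, inv_one, one_smul, hexp, gibbsEntropy_def, gibbsState_apply, hZ, Complex.one_re, Real.log_one, zero_add,
    inv_one, one_mul, one_mul, hexp] at hS
  rw [hS, hH₀def, Matrix.mul_neg, Matrix.trace_neg, Complex.neg_re, Finset.mul_sum, Matrix.trace_sum, Complex.re_sum,
    ← Finset.sum_neg_distrib]
  refine Finset.sum_congr rfl fun k _ => ?_
  rw [trace_boxProd_mul_fermionEmbed hφ hσ htr hcard k, re_trace_mul_cfc_log (hpd k).1, neg_neg]

end Entropy

end Literature.MathematicalPhysics.QuantumLattice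

end
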